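import Mathlib
import HarnessLib

/-!
# Route `F4SubCurvatureDoor`, crux ⟨stmt-QuantumFields-23125⟩ `RationalToGeneral`: LINE g18-A v5 — CSF build-plan step C2′
# «no `W(F₄)`-invariant harmonics in degrees 1 … 5», PART 1 (coefficient mechanics; odd degrees; degree two)

PORT into `Theorems/` (so that it is importable by the holders of the registered stub `stub_channelShellForm` and by the
low-degree channel theorem `F4SubCurvatureDoorLowDegreeChannels`) of the route OWNER's sorry-free rung
`Cruxes/RationalToGeneral/Lines/sextic_channel_rung_CSF_C2.lean` (planner `ym-idea-3` g18, commit bbea2b239507, §§ A–D), verbatim up to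
the namespace.  The stub `ChannelShellForm` and T2′ need, for the channels `0 < L < 6`, that a HARMONIC homogeneous polynomial on `ℝ⁴`
of degree `L ∈ {1,…,5}` which is invariant under the Weyl group `W(F₄)` vanishes.  This part proves, with invariance stated at the
level of EVALUATIONS (as in the skeleton's `InClass`) and for a general finite index type:

* `coeff_bind₁_C_mul_X` — coefficients under the diagonal substitution `X_j ↦ ε_j X_j`: `coeff m = (∏ ε_j^{m_j}) · coeff m`;
* `coeff_eq_zero_of_odd_exponent` — invariance under ONE sign flip `x_i ↦ −x_i` kills every monomial with `m_i` odd;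
* `eq_zero_of_isHomogeneous_odd` — odd degree + invariance under `x ↦ −x` ⇒ `P = 0`;
* `eq_zero_of_harmonic_even_symmetric_deg_two` — degree 2 + harmonic + sign flips + coordinate permutations ⇒ `P = 0`;
* `eval_indicator_eq_coeff_single` — evaluation at `e_j` reads the coefficient of `x_j^L`.

PART 2 (`F4SubCurvatureDoorLowDegreeInvariants.lean`) does degree four on `ℝ⁴` (the `F₄` Hadamard step) and assembles `0 < L < 6`.
THEOREMS ONLY; Mathlib only; no `sorry`; standard axioms.  HONEST LABEL: classical algebra [folklore]; closes no stub by itself;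
`ChannelShellForm`, T1″, C3, ⟨23125⟩ / ⟨23035⟩, rung R2d and the summit remain OPEN; the Yang–Mills mass gap is NOT proved.
Seat `ym-line-frs-p2` g14 (free hands), `--supports stmt-QuantumFields-23125`.
-/

set_option autoImplicit false

namespace Summit.QuantumFields.YangMills.Theorems.F4SubCurvatureDoorLowDegreeInvariants

open MvPolynomial
open scoped BigOperators

/-! ## § A. Coefficients under a diagonal rescaling of the variables -/

/-- `X_j ↦ ε_j X_j` maps the monomial `r·x^d` to `(r ∏ ε_j^{d_j})·x^d`. [folklore] -/
theorem bind₁_C_mul_X_monomial {σ R : Type*} [CommSemiring R] (ε : σ → R) (d : σ →₀ ℕ) (r : R) :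
    bind₁ (fun j => C (ε j) * X j) (monomial d r) = monomial d (r * ∏ j ∈ d.support, ε j ^ d j) := by
  rw [bind₁_monomial]
  have h : (∏ j ∈ d.support, (C (ε j) * X j : MvPolynomial σ R) ^ d j)
      = C (∏ j ∈ d.support, ε j ^ d j) * ∏ j ∈ d.support, (X j : MvPolynomial σ R) ^ d j := by
    rw [map_prod, ← Finset.prod_mul_distrib]
    exact Finset.prod_congr rfl fun j _ => by rw [mul_pow, map_pow]
  rw [h, ← mul_assoc, ← map_mul, monomial_eq]
  rfl

/-- Coefficients under the diagonal substitution `X_j ↦ ε_j X_j`. [folklore] -/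
theorem coeff_bind₁_C_mul_X {σ R : Type*} [CommSemiring R] (ε : σ → R) (P : MvPolynomial σ R) (m : σ →₀ ℕ) :
    coeff m (bind₁ (fun j => C (ε j) * X j) P) = (∏ j ∈ m.support, ε j ^ m j) * coeff m P := by
  classical
  induction P using MvPolynomial.induction_on' with
  | monomial d r =>
    rw [bind₁_C_mul_X_monomial, coeff_monomial, coeff_monomial]
    split_ifs with h
    · subst h; ring
    · simp
  | add p q hp hq => simp only [map_add, coeff_add, hp, hq, mul_add]

/-- Evaluation of a substituted polynomial. [folklore] -/
theorem eval_bind₁_eq {σ : Type*} (g : σ → MvPolynomial σ ℝ) (x : σ → ℝ) (P : MvPolynomial σ ℝ) :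
    eval x (bind₁ g P) = eval (fun i => eval x (g i)) P :=
  eval₂Hom_bind₁ (RingHom.id ℝ) x g P

/-- An evaluation-level diagonal symmetry is a polynomial identity. [folklore] -/
theorem bind₁_signs_eq_self {σ : Type*} {P : MvPolynomial σ ℝ} (ε : σ → ℝ)
    (hflip : ∀ x : σ → ℝ, eval (fun j => ε j * x j) P = eval x P) :
    bind₁ (fun j => C (ε j) * X j) P = P := by
  refine MvPolynomial.funext fun x => ?_
  rw [eval_bind₁_eq]
  have : (fun i => eval x (C (ε i) * X i)) = fun j => ε j * x j := by
    funext i; simp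
  rw [this, hflip]

/-! ## § B. One sign flip kills the monomials with an odd exponent -/

/-- If `P(x₀,…,−x_i,…) = P(x)` for all real `x`, every monomial of `P` has an even exponent at `i`. [folklore] -/
theorem coeff_eq_zero_of_odd_exponent {σ : Type*} [DecidableEq σ] {P : MvPolynomial σ ℝ} (i : σ)
    (hflip : ∀ x : σ → ℝ, eval (fun j => (if j = i then (-1 : ℝ) else 1) * x j) P = eval x P)
    (m : σ →₀ ℕ) (hodd : Odd (m i)) : coeff m P = 0 := by
  have hP := bind₁_signs_eq_self (P := P) (fun j => if j = i then (-1 : ℝ) else 1) hflip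
  have hc := coeff_bind₁_C_mul_X (fun j => if j = i then (-1 : ℝ) else 1) P m
  rw [hP] at hc
  have hprod : (∏ j ∈ m.support, (if j = i then (-1 : ℝ) else 1) ^ m j) = (-1) ^ m i := by
    rw [Finset.prod_eq_single i]
    · simp
    · intro j _ hji; simp [hji]
    · intro hi
      have : m i = 0 := by simpa [Finsupp.mem_support_iff] using hi
      rw [this]; simp
  rw [hprod, hodd.neg_one_pow] at hc
  linarith

/-! ## § C. Odd degrees -/

/-- A homogeneous polynomial of ODD degree invariant under `x ↦ −x` is zero (degrees 1, 3, 5 of C2′; only the product of the four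
sign flips of `W(B₄)` is used; the scaling identity `φ(t·x) = tⁿ φ(x)` is inlined — many tree files carry it under the name
`eval_smul_of_isHomogeneous`). [folklore] -/
theorem eq_zero_of_isHomogeneous_odd {σ : Type*} {P : MvPolynomial σ ℝ} {L : ℕ} (hhom : P.IsHomogeneous L) (hL : Odd L)
    (hneg : ∀ x : σ → ℝ, eval (fun j => -x j) P = eval x P) : P = 0 := by
  refine MvPolynomial.funext fun x => ?_
  have h1 : eval ((-1 : ℝ) • x) P = (-1 : ℝ) ^ L * eval x P := by
    rw [eval_eq, eval_eq, Finset.mul_sum]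
    refine Finset.sum_congr rfl fun d hd => ?_
    simp only [Pi.smul_apply, smul_eq_mul, mul_pow, Finset.prod_mul_distrib, Finset.prod_pow_eq_pow_sum]
    rw [← hhom.degree_eq_sum_deg_support hd]
    ring
  have h2 : ((-1 : ℝ) • x) = fun j => -x j := by
    funext j; simp
  rw [h2, hneg x, hL.neg_one_pow] at h1
  rw [map_zero]
  linarith

/-! ## § D. Degree two -/

/-- Evaluation-level permutation symmetry is `rename`-invariance. [folklore] -/
theorem rename_eq_self_of_eval_perm {σ : Type*} {P : MvPolynomial σ ℝ} (τ : Equiv.Perm σ)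
    (hperm : ∀ x : σ → ℝ, eval (x ∘ τ) P = eval x P) : rename τ P = P := by
  refine MvPolynomial.funext fun x => ?_
  rw [eval_rename]
  exact hperm x

/-- Coefficient transport along a symmetry permutation. [folklore] -/
theorem coeff_mapDomain_eq_of_rename_eq {σ : Type*} {P : MvPolynomial σ ℝ} (τ : Equiv.Perm σ) (hτ : rename τ P = P)
    (d : σ →₀ ℕ) : coeff (Finsupp.mapDomain τ d) P = coeff d P := by
  have h := coeff_rename_mapDomain τ τ.injective P d
  rwa [hτ] at h

/-- The Laplacian's constant coefficient: `coeff 0 (Σᵢ ∂ᵢ²P) = 2 Σᵢ coeff (2eᵢ) P`. [folklore] -/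
theorem coeff_zero_laplacian {σ : Type*} [Fintype σ] [DecidableEq σ] (P : MvPolynomial σ ℝ) :
    coeff 0 (∑ i : σ, pderiv i (pderiv i P)) = ∑ i : σ, 2 * coeff (Finsupp.single i 2) P := by
  rw [coeff_sum]
  refine Finset.sum_congr rfl fun i _ => ?_
  rw [coeff_pderiv, coeff_pderiv, zero_add, ← Finsupp.single_add]
  simp only [Finsupp.coe_zero, Pi.zero_apply, Finsupp.single_eq_same]
  norm_num
  ring

/-- An even-exponent monomial of degree two is `2eᵢ`. [folklore] -/
theorem eq_single_two_of_even_of_degree_two {σ : Type*} [Fintype σ] [DecidableEq σ] (d : σ →₀ ℕ)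
    (heven : ∀ j, Even (d j)) (hdeg : d.degree = 2) : ∃ i, d = Finsupp.single i 2 := by
  rw [Finsupp.degree_eq_sum] at hdeg
  have hex : ∃ i, d i ≠ 0 := by
    by_contra h
    push Not at h
    have : ∑ i, d i = 0 := Finset.sum_eq_zero fun i _ => h i
    omega
  obtain ⟨i, hi⟩ := hex
  have hle : d i ≤ 2 := by
    rw [← hdeg]; exact Finset.single_le_sum (fun j _ => Nat.zero_le (d j)) (Finset.mem_univ i)
  obtain ⟨t, ht⟩ := heven i
  have hdi : d i = 2 := by omega
  have hrest : ∀ j, j ≠ i → d j = 0 := by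
    intro j hji
    have hsplit := Finset.add_sum_erase Finset.univ (fun k => d k) (Finset.mem_univ i)
    have hzero : ∑ k ∈ Finset.univ.erase i, d k = 0 := by omega
    exact (Finset.sum_eq_zero_iff.mp hzero) j (Finset.mem_erase.mpr ⟨hji, Finset.mem_univ j⟩)
  refine ⟨i, Finsupp.ext fun j => ?_⟩
  by_cases hji : j = i
  · subst hji; simp [hdi]
  · rw [hrest j hji, Finsupp.single_eq_of_ne hji]

/-- **C2′, degree two**: a harmonic homogeneous quadratic polynomial which is invariant (at the level of evaluations) under
every single sign flip and every permutation of the coordinates is zero (`P = a‖x‖²` and `ΔP = 2a·#σ`). [folklore] -/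
theorem eq_zero_of_harmonic_even_symmetric_deg_two {σ : Type*} [Fintype σ] [DecidableEq σ] {P : MvPolynomial σ ℝ}
    (hhom : P.IsHomogeneous 2) (hharm : ∑ i : σ, pderiv i (pderiv i P) = 0)
    (hsign : ∀ i : σ, ∀ x : σ → ℝ, eval (fun j => (if j = i then (-1 : ℝ) else 1) * x j) P = eval x P)
    (hperm : ∀ τ : Equiv.Perm σ, ∀ x : σ → ℝ, eval (x ∘ τ) P = eval x P) : P = 0 := by
  -- all diagonal coefficients agree
  have hdiag : ∀ i j : σ, coeff (Finsupp.single j 2) P = coeff (Finsupp.single i 2) P := by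
    intro i j
    have h := coeff_mapDomain_eq_of_rename_eq (Equiv.swap i j) (rename_eq_self_of_eval_perm _ (hperm _))
      (Finsupp.single i 2)
    rwa [Finsupp.mapDomain_single, Equiv.swap_apply_left] at h
  -- harmonicity: the common diagonal coefficient vanishes
  have hzero : ∀ i : σ, coeff (Finsupp.single i 2) P = 0 := by
    intro i
    have h := congrArg (coeff (0 : σ →₀ ℕ)) hharm
    rw [coeff_zero_laplacian, coeff_zero] at h
    rw [Finset.sum_congr rfl fun j _ => by rw [hdiag i j]] at h
    rw [Finset.sum_const, Finset.card_univ, nsmul_eq_mul] at h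
    have hcard : (0 : ℝ) < Fintype.card σ := by
      exact_mod_cast Fintype.card_pos_iff.mpr ⟨i⟩
    nlinarith
  -- conclude coefficientwise
  ext d
  rw [coeff_zero]
  by_cases hdeg : d.degree = 2
  · by_cases hodd : ∃ i, Odd (d i)
    · obtain ⟨i, hi⟩ := hodd
      exact coeff_eq_zero_of_odd_exponent i (hsign i) d hi
    · push Not at hodd
      obtain ⟨i, rfl⟩ := eq_single_two_of_even_of_degree_two d (fun j => Nat.not_odd_iff_even.mp (hodd j)) hdeg
      exact hzero i
  · exact hhom.coeff_eq_zero hdeg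


/-- Evaluation at a coordinate vector picks the pure-power coefficient of a homogeneous polynomial. [folklore] -/
theorem eval_indicator_eq_coeff_single {σ : Type*} [Fintype σ] [DecidableEq σ] {P : MvPolynomial σ ℝ} {L : ℕ}
    (hhom : P.IsHomogeneous L) (j : σ) :
    eval (fun i => if i = j then (1 : ℝ) else 0) P = coeff (Finsupp.single j L) P := by
  rw [eval_eq']
  have key : ∀ d ∈ P.support, coeff d P * ∏ i, (if i = j then (1 : ℝ) else 0) ^ d i
      = if d = Finsupp.single j L then coeff d P else 0 := by
    intro d hd
    have hdeg : d.degree = L := by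
      by_contra h; exact (mem_support_iff.mp hd) (hhom.coeff_eq_zero h)
    by_cases h : d = Finsupp.single j L
    · rw [if_pos h]
      have hone : (∏ i, (if i = j then (1 : ℝ) else 0) ^ d i) = 1 := by
        refine Finset.prod_eq_one fun i _ => ?_
        by_cases hij : i = j
        · rw [if_pos hij, one_pow]
        · have : d i = 0 := by rw [h, Finsupp.single_apply, if_neg (Ne.symm hij)]
          rw [this, pow_zero]
      rw [hone, mul_one]
    · rw [if_neg h]
      have hex : ∃ i, i ≠ j ∧ d i ≠ 0 := by
        by_contra hno
        push Not at hno
        apply h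
        ext i
        by_cases hij : i = j
        · subst hij
          rw [Finsupp.single_eq_same, ← hdeg, Finsupp.degree_eq_sum,
            ← Finset.add_sum_erase _ _ (Finset.mem_univ i)]
          rw [Finset.sum_eq_zero fun k hk => hno k (Finset.ne_of_mem_erase hk)]
          simp
        · rw [hno i hij, Finsupp.single_apply, if_neg (Ne.symm hij)]
      obtain ⟨i, hij, hi⟩ := hex
      have hz : (∏ i, (if i = j then (1 : ℝ) else 0) ^ d i) = 0 :=
        Finset.prod_eq_zero (Finset.mem_univ i) (by rw [if_neg hij]; exact zero_pow hi)
      rw [hz, mul_zero]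
  rw [Finset.sum_congr rfl key, Finset.sum_ite_eq']
  split_ifs with hmem
  · rfl
  · symm; simpa [mem_support_iff] using hmem

end Summit.QuantumFields.YangMills.Theorems.F4SubCurvatureDoorLowDegreeInvariants
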